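/-
Copyright (c) 2026 the pub-hodgecm-mathlib formalisation cell (harness21).  Prover seat hodgecm-mathlib-K2Liu-p02 (g7), Track B «K2-LIT» ∕ hLiu418
#184♮, #42S payer road (σ), V5-inst (f) PART 2b file 2a — the HERMITIAN moment coordinates at `n = 2` (K2Liu-p02 (g7) bus 14:08∕14:2xZ; K2Liu-p09 (g6)
assembly `faceA4R_two_of_record` sockets `{ι} nΔ hnΔ q hq ψ hm hN hNρ hNa htrans`).  DEFINITION LANE (`qHerm`) + theorems.
-/
import Summits.HodgeConjecture.HodgeConjecture.Theorems.K2LiuA7ValueUnipotentPins          -- ★ p860598 (`bmat`, `gramLoc`, `qLoc`, `hq∕hNρ∕hNa∕htrans` in `qLoc` currency)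
import Summits.HodgeConjecture.HodgeConjecture.Theorems.K2LiuLeviDeltaBlockDSurjective      -- ★ p860651 (`hsurj` letter)
import Literature.NumberTheory.Automorphic.UnitaryGroupDoubledBigCellNonsplit                -- ★ `conjLocal_conjLocal`
import HarnessLib

/-!
# Crux `HLiu418`, (σ) V5-inst (f), file 2a: THE FOUR HERMITIAN MOMENT COORDINATES `q = qHerm = (G₀₀, G₁₁, re G₀₁, im G₀₁)` OF THE GRAM MATRIX AT `n = 2`,
# AND THE SOCKETS `hq`, `hNρ`, `hNa`, `htrans` OF `faceA4R_two_of_record` IN THAT CURRENCY (`ι := Fin 4`)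

Cell `hodgecm-mathlib`, crux item hLiu418 = `stmt-HodgeConjecture-24832`; squad K2 ∕ K2Liu; prover K2Liu-p02 (g7).  DEFINITION LANE: one `def` (`qHerm`); everything else
theorems; no instance, no notation, no `sorry`; lane `--supports stmt-HodgeConjecture-24832 --as helper`.

WHY `ι = Fin 4` (bus 14:08:05Z).  ★ V8e's `hN : ω(nΔ η) Φ x = ψ(η ⬝ᵥ q x) · Φ x` is quantified over ALL `η : ι → L⁺_v`, so `η ↦ nΔ η` parametrises `N_Δ(L⁺_v) ≅ Herm₂(L ⊗ L⁺_v)`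
(`n² = 4` coordinates over `L⁺_v`) and `q` is the DUAL moment map.  The Gram matrix `G = gramLoc b` (★ p860598) is `σ`-hermitian (`gramLoc_conjTranspose`), so its four
hermitian coordinates **`qHerm x := (re G₀₀, re G₁₁, re G₀₁, im G₀₁)`** (`G = gramLoc (R⁻¹ x)`) determine it: **`qHerm_eq_zero_iff : qHerm x = 0 ↔ gramLoc (R⁻¹ x) = 0`** (`↔ qLoc x = 0`,
★ p860598).  Hence the ★ sockets transfer verbatim: **`continuous_qHerm`** (= `hq`), **`qHerm_rhoLoc`**∕**`qHerm_rhoLoc_eq_zero`** (= `hNρ`), **`qHerm_leviRhoLoc_eq_zero`** (= `hNa`),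
**`exists_leviRhoLoc_rhoLoc_eq_of_qHerm`** (= `htrans` at a NON-SPLIT place, with ★ p860651 `exists_mem_leviDeltaLoc_blkD_eq` discharging `hsurj`; generic Gram datum
`{T₀} (hT₀ hT₀d hJD)` of ★ I-2).  All factors∕signs of the pairing `(t, G) ↦ im tr(T₀ t Gᵀ)` (★ file 1 `half_deltaGram_reFrame_reFrame`) go into the table `η ↦ t_η` of `nΔ` (file 2b).
References: [Kudla1994] §3 Thm. 3.1; [MoeglinVignerasWaldspurger1987] Chap. 3 IV; [KudlaRallis1994] §2.
HONEST LABEL.  Count-neutral helper: `HC_CM` is proved only modulo the 7 printed citations (2 remaining named inputs: hLiu418 = `stmt-HodgeConjecture-24832`,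
h413 = `stmt-HodgeConjecture-24833`) until rung 0 closes.
-/

set_option autoImplicit false
set_option linter.dupNamespace false -- the mandated namespace repeats `HodgeConjecture.HodgeConjecture`
set_option synthInstance.maxHeartbeats 200000 -- rectangular matrix products over the Π-type `L ⊗ L⁺_v` (as ★ p860598)

noncomputable section

open scoped Matrix
open NumberField IsDedekindDomain Matrix Topology
open Literature.NumberTheory.Automorphic Literature.NumberTheory.Automorphic.UnitaryGroup
open Literature.NumberTheory.Automorphic.UnitaryGroup.QuadraticCoordinates
open Literature.NumberTheory.GelbartRogawski1991 Literature.NumberTheory.GelbartRogawski1991.GRConstruction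
open Literature.NumberTheory.GelbartRogawski1991.UnitaryDualPair
open Literature.NumberTheory.GelbartRogawski1991.UnitaryDualPair.LocalSplitting
open Literature.NumberTheory.GelbartRogawski1991.AdaptedBlocks
open Literature.NumberTheory.K2Lit.SiegelDoubled
open Summit.HodgeConjecture.HodgeConjecture.Cruxes.HLiu418.K2LiuDeltaModelRealFrame
open Summit.HodgeConjecture.HodgeConjecture.Cruxes.HLiu418.K2LiuA7ValueInstanceDefs
open Summit.HodgeConjecture.HodgeConjecture.Cruxes.HLiu418.K2LiuA7ValueUnipotentPins
open Summit.HodgeConjecture.HodgeConjecture.Cruxes.HLiu418.K2LiuLeviDeltaBlockDSurjective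

namespace Summit.HodgeConjecture.HodgeConjecture.Cruxes.HLiu418.K2LiuA7ValueUnipotentPinsHerm

section Herm

variable (L : Type) [Field L] [NumberField L] [IsCMField L] [Algebra.IsQuadraticExtension (Fp L) L]
  {δ : L} (hcδ : IsCMField.complexConj L δ = -δ) (hδ : δ ≠ 0)
variable {N M : ℕ} (e : Fin N × Fin M ≃ Fin 2)
  (dV : Fin N → L) (hdV : ∀ i, IsCMField.complexConj L (dV i) = dV i)
  (dW : Fin M → L) (hdW : ∀ i, IsCMField.complexConj L (dW i) = dW i)
variable {M₂ M' n' : ℕ} (eW : Fin M × Fin M₂ ≃ Fin M') (e' : Fin N × Fin M' ≃ Fin n')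
  (dV' : Fin M₂ → L) (hdV' : ∀ k, IsCMField.complexConj L (dV' k) = dV' k)
variable (v : HeightOneSpectrum (𝓞 (Fp L)))

/-! ## §1 The Gram matrix is hermitian -/

omit [Algebra.IsQuadraticExtension (Fp L) L] in
include hdV' in
/-- the local Gram matrix `J′_v` of `V′ = (L^{M₂}, diag dV′)` is real-diagonal, hence `σ`-hermitian and symmetric. [cite: Kudla1994, §3] -/
theorem localGram_diagonal_hermitian :
    (((adelicForm L M₂ (Matrix.diagonal dV')).map (adeleToLocal L v)).map (conjLocal L (IsCMField.complexConj L) v))ᵀ =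
        (adelicForm L M₂ (Matrix.diagonal dV')).map (adeleToLocal L v) ∧
      ((adelicForm L M₂ (Matrix.diagonal dV')).map (adeleToLocal L v))ᵀ = (adelicForm L M₂ (Matrix.diagonal dV')).map (adeleToLocal L v) := by
  have hform : (adelicForm L M₂ (Matrix.diagonal dV')).map (adeleToLocal L v) =
      Matrix.diagonal fun k => adeleToLocal L v (algebraMap L (AdeleRing (𝓞 L) L) (dV' k)) := by
    rw [adelicForm, Matrix.diagonal_map (map_zero _), Matrix.diagonal_map (map_zero _)]
  refine ⟨?_, ?_⟩
  · rw [hform, Matrix.diagonal_map (map_zero _), Matrix.diagonal_transpose]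
    refine congrArg Matrix.diagonal (funext fun k => ?_)
    rw [adeleToLocal_algebraMap, conjLocal_algebraMap, hdV']
  · rw [hform, Matrix.diagonal_transpose]

include hcδ hδ hdV' in
/-- **the Gram matrix of a pair is `σ`-hermitian**: `((gramLoc b)^σ)ᵀ = gramLoc b`. [cite: Kudla1994, §3] -/
theorem gramLoc_conjTranspose {n : ℕ} (e₀ : Fin N × Fin M ≃ Fin n) (b : Fin n' → LocalRing L v) :
    ((gramLoc L e₀ eW e' dV' v b).map (conjLocal L (IsCMField.complexConj L) v))ᵀ = gramLoc L e₀ eW e' dV' v b := by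
  obtain ⟨hJσ, -⟩ := localGram_diagonal_hermitian L dV' hdV' v (M₂ := M₂)
  have hσσ : ((bmat L e₀ eW e' v b).map (conjLocal L (IsCMField.complexConj L) v)).map (conjLocal L (IsCMField.complexConj L) v) = bmat L e₀ eW e' v b :=
    Matrix.ext fun i k => conjLocal_conjLocal (IsCMField.complexConj L) v hcδ hδ _
  rw [gramLoc, Matrix.map_mul, Matrix.map_mul, hσσ, Matrix.transpose_map, Matrix.transpose_mul, Matrix.transpose_mul, Matrix.transpose_transpose,
    hJσ, Matrix.mul_assoc]

include hcδ hδ hdV' in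
/-- entrywise: `σ (G j i) = G i j`. [cite: Kudla1994, §3] -/
theorem conjLocal_gramLoc_apply {n : ℕ} (e₀ : Fin N × Fin M ≃ Fin n) (b : Fin n' → LocalRing L v) (i j : Fin n) :
    conjLocal L (IsCMField.complexConj L) v (gramLoc L e₀ eW e' dV' v b j i) = gramLoc L e₀ eW e' dV' v b i j := by
  have h := congrFun (congrFun (gramLoc_conjTranspose L hcδ hδ eW e' dV' hdV' v e₀ b) i) j
  rwa [Matrix.transpose_apply, Matrix.map_apply] at h

/-- in quadratic coordinates: `σ z = z → im z = 0`, and then `re z = 0 → z = 0`. [folklore] -/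
theorem eq_zero_of_conj_eq_of_re_eq_zero {z : LocalRing L v} (hz : conjLocal L (IsCMField.complexConj L) v z = z)
    (hre : re (quadraticLocalEquiv L v (IsCMField.complexConj L) hcδ hδ).toLinearEquiv.toAddEquiv z = 0) : z = 0 := by
  set Ψ := quadraticLocalEquiv L v (IsCMField.complexConj L) hcδ hδ with hΨ
  have hz' := hz
  conv_lhs at hz' => rw [← apply_re_im Ψ.toLinearEquiv.toAddEquiv z]
  conv_rhs at hz' => rw [← apply_re_im Ψ.toLinearEquiv.toAddEquiv z]
  change conjLocal L (IsCMField.complexConj L) v (Ψ (_, _)) = Ψ (_, _) at hz'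
  rw [conjLocal_quadraticLocalEquiv] at hz'
  have him : -im Ψ.toLinearEquiv.toAddEquiv z = im Ψ.toLinearEquiv.toAddEquiv z := (Prod.ext_iff.1 (Ψ.injective hz')).2
  have him0 : im Ψ.toLinearEquiv.toAddEquiv z = 0 := by
    have h2 : (2 : v.adicCompletion (Fp L)) * im Ψ.toLinearEquiv.toAddEquiv z = 0 := by linear_combination -him
    exact (mul_eq_zero.1 h2).resolve_left two_ne_zero
  rw [← apply_re_im Ψ.toLinearEquiv.toAddEquiv z, hre, him0]
  exact map_zero Ψ

/-! ## §2 The hermitian moment coordinates `qHerm` (`n = 2`, `ι = Fin 4`) -/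

/-- **`qHerm x := (re G₀₀, re G₁₁, re G₀₁, im G₀₁)`**, `G = gramLoc (R⁻¹ x)` — the four `L⁺_v`-coordinates of the `σ`-hermitian `2 × 2` Gram matrix of the pair of vectors of `V′_v`;
the `q` socket (`ι := Fin 4`) of `faceA4R_two_of_record`. [cite: Kudla1994, §3 Thm. 3.1] [cite: KudlaRallis1994, §2] -/
def qHerm (x : Fin (n' + n') → v.adicCompletion (Fp L)) : Fin 4 → v.adicCompletion (Fp L) :=
  ![re (quadraticLocalEquiv L v (IsCMField.complexConj L) hcδ hδ).toLinearEquiv.toAddEquiv ((gramLoc L e eW e' dV' v ((reFrame (Fp L) L (IsCMField.complexConj L) hcδ hδ v n').symm x)) 0 0), re (quadraticLocalEquiv L v (IsCMField.complexConj L) hcδ hδ).toLinearEquiv.toAddEquiv ((gramLoc L e eW e' dV' v ((reFrame (Fp L) L (IsCMField.complexConj L) hcδ hδ v n').symm x)) 1 1), re (quadraticLocalEquiv L v (IsCMField.complexConj L) hcδ hδ).toLinearEquiv.toAddEquiv ((gramLoc L e eW e' dV' v ((reFrame (Fp L) L (IsCMField.complexConj L) hcδ hδ v n').symm x)) 0 1),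 im (quadraticLocalEquiv L v (IsCMField.complexConj L) hcδ hδ).toLinearEquiv.toAddEquiv ((gramLoc L e eW e' dV' v ((reFrame (Fp L) L (IsCMField.complexConj L) hcδ hδ v n').symm x)) 0 1)]

include hdV' in
/-- **`{qHerm = 0}` IS THE NULL CONE**: `qHerm x = 0 ↔ gramLoc (R⁻¹ x) = 0` (hermitian symmetry). [cite: Kudla1994, §3 Thm. 3.1] -/
theorem qHerm_eq_zero_iff (x : Fin (n' + n') → v.adicCompletion (Fp L)) :
    qHerm L hcδ hδ e eW e' dV' v x = 0 ↔ (gramLoc L e eW e' dV' v ((reFrame (Fp L) L (IsCMField.complexConj L) hcδ hδ v n').symm x)) = 0 := by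
  constructor
  · intro h
    have h0 : re (quadraticLocalEquiv L v (IsCMField.complexConj L) hcδ hδ).toLinearEquiv.toAddEquiv ((gramLoc L e eW e' dV' v ((reFrame (Fp L) L (IsCMField.complexConj L) hcδ hδ v n').symm x)) 0 0) = 0 := by simpa [qHerm] using congrFun h 0
    have h1 : re (quadraticLocalEquiv L v (IsCMField.complexConj L) hcδ hδ).toLinearEquiv.toAddEquiv ((gramLoc L e eW e' dV' v ((reFrame (Fp L) L (IsCMField.complexConj L) hcδ hδ v n').symm x)) 1 1) = 0 := by simpa [qHerm] using congrFun h 1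
    have h2 : re (quadraticLocalEquiv L v (IsCMField.complexConj L) hcδ hδ).toLinearEquiv.toAddEquiv ((gramLoc L e eW e' dV' v ((reFrame (Fp L) L (IsCMField.complexConj L) hcδ hδ v n').symm x)) 0 1) = 0 := by simpa [qHerm] using congrFun h 2
    have h3 : im (quadraticLocalEquiv L v (IsCMField.complexConj L) hcδ hδ).toLinearEquiv.toAddEquiv ((gramLoc L e eW e' dV' v ((reFrame (Fp L) L (IsCMField.complexConj L) hcδ hδ v n').symm x)) 0 1) = 0 := by simpa [qHerm] using congrFun h 3
    have g00 : (gramLoc L e eW e' dV' v ((reFrame (Fp L) L (IsCMField.complexConj L) hcδ hδ v n').symm x)) 0 0 = 0 := eq_zero_of_conj_eq_of_re_eq_zero L hcδ hδ v (conjLocal_gramLoc_apply L hcδ hδ eW e' dV' hdV' v e _ 0 0) h0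
    have g11 : (gramLoc L e eW e' dV' v ((reFrame (Fp L) L (IsCMField.complexConj L) hcδ hδ v n').symm x)) 1 1 = 0 := eq_zero_of_conj_eq_of_re_eq_zero L hcδ hδ v (conjLocal_gramLoc_apply L hcδ hδ eW e' dV' hdV' v e _ 1 1) h1
    have g01 : (gramLoc L e eW e' dV' v ((reFrame (Fp L) L (IsCMField.complexConj L) hcδ hδ v n').symm x)) 0 1 = 0 := by
      rw [← apply_re_im (quadraticLocalEquiv L v (IsCMField.complexConj L) hcδ hδ).toLinearEquiv.toAddEquiv ((gramLoc L e eW e' dV' v ((reFrame (Fp L) L (IsCMField.complexConj L) hcδ hδ v n').symm x)) 0 1), h2, h3]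
      exact map_zero _
    have g10 : (gramLoc L e eW e' dV' v ((reFrame (Fp L) L (IsCMField.complexConj L) hcδ hδ v n').symm x)) 1 0 = 0 := by
      rw [← conjLocal_gramLoc_apply L hcδ hδ eW e' dV' hdV' v e _ 1 0, g01, map_zero]
    refine Matrix.ext fun i j => ?_
    fin_cases i <;> fin_cases j
    · exact g00
    · exact g01
    · exact g10
    · exact g11
  · intro h
    funext i
    fin_cases i <;> simp [qHerm, h]

/-- `qHerm = 0 ↔ qLoc = 0` (★ p860598 `qLoc_eq_zero_iff`). [cite: Kudla1994, §3 Thm. 3.1] -/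
theorem qHerm_eq_zero_iff_qLoc (hdV' : ∀ k, IsCMField.complexConj L (dV' k) = dV' k) (x : Fin (n' + n') → v.adicCompletion (Fp L)) :
    qHerm L hcδ hδ e eW e' dV' v x = 0 ↔ qLoc L hcδ hδ e eW e' dV' v x = 0 := by
  rw [qHerm_eq_zero_iff L hcδ hδ e eW e' dV' hdV' v, qLoc_eq_zero_iff]

/-- **`hq`: `qHerm` is continuous.** [folklore] -/
theorem continuous_qHerm : Continuous (qHerm L hcδ hδ e eW e' dV' v (n' := n')) := by
  have hg : Continuous fun x : Fin (n' + n') → v.adicCompletion (Fp L) => (gramLoc L e eW e' dV' v ((reFrame (Fp L) L (IsCMField.complexConj L) hcδ hδ v n').symm x)) :=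
    (continuous_gramLoc L e eW e' dV' v).comp (continuous_reFrame_symm L hcδ hδ v)
  have hre : ∀ i j : Fin 2, Continuous fun x : Fin (n' + n') → v.adicCompletion (Fp L) => re (quadraticLocalEquiv L v (IsCMField.complexConj L) hcδ hδ).toLinearEquiv.toAddEquiv ((gramLoc L e eW e' dV' v ((reFrame (Fp L) L (IsCMField.complexConj L) hcδ hδ v n').symm x)) i j) := fun i j =>
    continuous_fst.comp ((quadraticLocalEquiv L v (IsCMField.complexConj L) hcδ hδ).symm.continuous.comp ((continuous_apply j).comp ((continuous_apply i).comp hg)))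
  have him : ∀ i j : Fin 2, Continuous fun x : Fin (n' + n') → v.adicCompletion (Fp L) => im (quadraticLocalEquiv L v (IsCMField.complexConj L) hcδ hδ).toLinearEquiv.toAddEquiv ((gramLoc L e eW e' dV' v ((reFrame (Fp L) L (IsCMField.complexConj L) hcδ hδ v n').symm x)) i j) := fun i j =>
    continuous_snd.comp ((quadraticLocalEquiv L v (IsCMField.complexConj L) hcδ hδ).symm.continuous.comp ((continuous_apply j).comp ((continuous_apply i).comp hg)))
  refine continuous_pi fun s => ?_
  fin_cases s
  · simpa [qHerm] using hre 0 0
  · simpa [qHerm] using hre 1 1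
  · simpa [qHerm] using hre 0 1
  · simpa [qHerm] using him 0 1

/-! ## §3 The sockets `hNρ`, `hNa` in `qHerm` currency -/

/-- **`hNρ` (EXACT)**: `qHerm (ρ g x) = qHerm x`. [cite: Kudla1994, §3 Thm. 3.1] [cite: MoeglinVignerasWaldspurger1987, Chap. 3 IV] -/
theorem qHerm_rhoLoc (g : UnitaryGroup.localPi L (IsCMField.complexConj L) M₂ (Matrix.diagonal dV') v) (x : Fin (n' + n') → v.adicCompletion (Fp L)) :
    qHerm L hcδ hδ e eW e' dV' v (rhoLoc L hcδ hδ e dV hdV dW hdW eW e' dV' hdV' v g x) = qHerm L hcδ hδ e eW e' dV' v x := by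
  unfold qHerm
  rw [gramLoc_reFrame_symm_rhoLoc]

/-- the socket shape: `qHerm x = 0 → qHerm (ρ g x) = 0`. [cite: Kudla1994, §3 Thm. 3.1] -/
theorem qHerm_rhoLoc_eq_zero (g : UnitaryGroup.localPi L (IsCMField.complexConj L) M₂ (Matrix.diagonal dV') v) (x : Fin (n' + n') → v.adicCompletion (Fp L))
    (hx : qHerm L hcδ hδ e eW e' dV' v x = 0) : qHerm L hcδ hδ e eW e' dV' v (rhoLoc L hcδ hδ e dV hdV dW hdW eW e' dV' hdV' v g x) = 0 := by
  rw [qHerm_rhoLoc, hx]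

/-- **`hNa`**: `qHerm x = 0 → qHerm (aX m x) = 0`. [cite: Kudla1994, §3 Thm. 3.1] [cite: KudlaRallis1994, §2] -/
theorem qHerm_leviRhoLoc_eq_zero (m : ↥(leviDeltaLoc L e dV hdV dW hdW v)) (x : Fin (n' + n') → v.adicCompletion (Fp L))
    (hx : qHerm L hcδ hδ e eW e' dV' v x = 0) : qHerm L hcδ hδ e eW e' dV' v (leviRhoLoc L hcδ hδ e dV hdV dW hdW eW e' dV' hdV' v m x) = 0 := by
  rw [qHerm_eq_zero_iff_qLoc L hcδ hδ e eW e' dV' v hdV'] at hx ⊢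
  exact qLoc_leviRhoLoc_eq_zero L hcδ hδ e dV hdV dW hdW eW e' dV' hdV' v m x hx

end Herm

/-! ## §4 The socket `htrans` in `qHerm` currency (`M₂ = 3`, non-split `v`), `hsurj` discharged -/

section Trans

variable (L : Type) [Field L] [NumberField L] [IsCMField L] [Algebra.IsQuadraticExtension (Fp L) L]
  {δ : L} (hcδ : IsCMField.complexConj L δ = -δ) (hδ : δ ≠ 0) {d : Fp L} (hd : δ * δ = algebraMap (Fp L) L d)
variable {N M : ℕ} (e : Fin N × Fin M ≃ Fin 2)
  (dV : Fin N → L) (hdV : ∀ i, IsCMField.complexConj L (dV i) = dV i)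
  (dW : Fin M → L) (hdW : ∀ i, IsCMField.complexConj L (dW i) = dW i)
variable {M' n' : ℕ} (eW : Fin M × Fin 3 ≃ Fin M') (e' : Fin N × Fin M' ≃ Fin n')
  (dV' : Fin 3 → L) (hdV' : ∀ k, IsCMField.complexConj L (dV' k) = dV' k)
variable (v : HeightOneSpectrum (𝓞 (Fp L)))
  {T₀ : Matrix (Fin 2) (Fin 2) (Fp L)} (hT₀ : T₀.IsSymm) (hT₀d : IsUnit T₀.det)
  (hJD : hermD L e dV hdV dW hdW = (gramD (Fp L) 2 T₀).map (algebraMap (Fp L) L))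

include hd hT₀ hT₀d hJD in
/-- **`htrans` at a NON-SPLIT place, `qHerm` currency, no by-value letter left**: for `x, y ≠ 0` with `qHerm x = qHerm y = 0` there are `m ∈ M_Δ`, `g ∈ U(V′)(L⁺_v)` with
`aX m (ρ g x) = y` (★ p860598 `exists_leviRhoLoc_rhoLoc_eq` + ★ p860651 `exists_mem_leviDeltaLoc_blkD_eq`). [cite: Kudla1994, §3 Thm. 3.1] [cite: MoeglinVignerasWaldspurger1987, Chap. 3 IV] -/
theorem exists_leviRhoLoc_rhoLoc_eq_of_qHerm (hc : IsCMField.complexConj L ≠ 1) (w : UnitaryGroup.PlacesOver L v) (hw : IsCMField.complexConj L • w.1 = w.1)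
    (hdV'0 : ∀ k, dV' k ≠ 0) (x y : Fin (n' + n') → v.adicCompletion (Fp L))
    (hx : qHerm L hcδ hδ e eW e' dV' v x = 0) (hy : qHerm L hcδ hδ e eW e' dV' v y = 0) (hx0 : x ≠ 0) (hy0 : y ≠ 0) :
    ∃ (m : ↥(leviDeltaLoc L e dV hdV dW hdW v)) (g : UnitaryGroup.localPi L (IsCMField.complexConj L) 3 (Matrix.diagonal dV') v),
      leviRhoLoc L hcδ hδ e dV hdV dW hdW eW e' dV' hdV' v m (rhoLoc L hcδ hδ e dV hdV dW hdW eW e' dV' hdV' v g x) = y :=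
  exists_leviRhoLoc_rhoLoc_eq L hcδ hδ e dV hdV dW hdW eW e' dV' hdV' v hc w hw hdV'0
    (exists_mem_leviDeltaLoc_blkD_eq L hcδ hδ hd e dV hdV dW hdW v hT₀ hT₀d hJD) x y
    ((qHerm_eq_zero_iff_qLoc L hcδ hδ e eW e' dV' v hdV' x).1 hx) ((qHerm_eq_zero_iff_qLoc L hcδ hδ e eW e' dV' v hdV' y).1 hy) hx0 hy0

end Trans

end Summit.HodgeConjecture.HodgeConjecture.Cruxes.HLiu418.K2LiuA7ValueUnipotentPinsHerm

end
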